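import Summits.QuantumFields.YangMills.Theorems.BalabanUVNodesN19OffWindowPrice
import Summits.QuantumFields.YangMills.Theorems.BalabanUVNodesN19NoLinearPrice
import Mathlib.Analysis.Convex.SpecificFunctions.Basic

/-!
# YM-DAG node N19 (= NE7 proper) — THE OFF-WINDOW PRICE IS TWO-SIDED: the grid-Chebyshev pairs of p510514, read OFF the window, lose exactly the
# Chebyshev growth `cosh(M·arcosh(t∕l₀))` — exponent `1 − Θ(arcosh(t∕l₀)∕log log ε⁻¹)` on both sides

Cell `pub-ymgap`, HUMAN RULING D-0062 (Track A), R141 (C) wider-strategy seat `pub-ymgap-dag-n19-e` (strategy s3 = ALTERNATIVE CURRENCY), generation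
g14, module 3 (siblings: p521610 `…N19OffWindowPrice` — the UPPER half; `…N19OffWindowPriceAtScheme` — the scheme faces).  Route
`Summits/QuantumFields/YangMills/Theses/BalabanUVNodes.lean` rev 21, cluster item K3⁵ «SpineGivenEndpointR13SepCoP» (stmt-QuantumFields-20296; KEY-20 ∕ dag-lead WORDS-141 — p521610
was filed on the ⁗ item 20292 before the re-key); filed `--supports` that item `--as helper` (it proves no registered stub).  COUNT-NEUTRAL: elementary, over Mathlib (`Polynomial.Chebyshev.T_real_cosh`, Bernoulli's inequality
`one_add_mul_self_le_rpow_one_add`) and the seat's modules BY NAME — p509390 `…N19NoLinearPriceWitness` (the transported Chebyshev polynomial: `eval_chebAff`,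
`natDegree_chebAff`, `sum_abs_coeff_chebAff_le`, `pow_le_sum_abs_coeff_chebAff`, `sum_coeff_chebAff_eq_zero`, `abs_eval_chebAff_le_one`), p510514 `…N19NoLinearPrice`
(`expsum_eq_eval`, `abs_expm1_ratio_le_one`, `exists_lawPair_of_weights`, `exp_neg_le_mgf_of_Icc`, `abs_log_sub_log_le`), p521610 (the upper half); NOT a discharge claim.

WHAT IT SAYS.  p521610: cgf's of `[−B, B]`-bounded observables `ε`-close on `|t| ≤ l₀` are `2e^{l₀B}·ε^{1 − 2·arcosh(|t|∕l₀)∕arcosh(1 + log⁺ε⁻¹∕(l₀B))}`-close at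
every real source.  HERE THE LOWER HALF, by the SAME family that made the expectation price sharp (p510514 ∕ p517472): the signed grid measure with weights
`w_j = (2∕Λ)·[uʲ]P_M`, `P_M = T_M ∘ ((u − 1)∕r)`, `r = e^{l₀∕M} − 1`, has `Σ_j w_j e^{tj∕M} = ε·P_M(e^{t∕M})` with `ε = 2∕Λ`; on the window `|P_M| ≤ 1`, and OFF
the window, at `t ≥ l₀`, the affine argument is `(e^{t∕M} − 1)∕(e^{l₀∕M} − 1) ≥ t∕l₀` (Bernoulli), where `T_M(x) = cosh(M·arcosh x)` is increasing: §2 ★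
`exists_expsum_witness_offWindow` — `Σ_j w_j e^{tj∕M} ≥ ε·cosh(M·arcosh(t∕l₀))` for every `t ≥ l₀`.  §3 turns the weights into two probability laws on `[0, 1]`
(p510514's `exists_lawPair_of_weights`): ★ `exists_mgf_close_far_offWindow`, ★ `exists_cgf_close_far_offWindow`.  §4 the exponent form: since `ε ≥ 2(1 + 4M∕l₀)^{−M}`,
`cosh(M·v) ≥ ½(ε∕2)^{−v∕log(1+4M∕l₀)}`, so ★★ `offWindow_price_two_sided`: for every `0 < l₀` and odd `M` two probability laws on `[0, 1]` and `ε` with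
`0 < ε ≤ 4(l₀e^{l₀}∕(2M))^M`, cgf's `e^{l₀}ε`-close on `|t| ≤ l₀`, and at every `t ≥ l₀`
`e^{−t}·(ε∕2)^{1 − arcosh(t∕l₀)∕log(1 + 4M∕l₀)} ≤ |cgf_ν(t) − cgf_μ(t)| ≤ 2e^{l₀+t}·(e^{l₀}ε)^{1 − 2·arcosh(t∕l₀)∕arcosh(1 + log⁺(e^{l₀}ε)⁻¹∕l₀)}`
(the upper half wherever p521610 covers, `t − l₀ ≤ log⁺(e^{l₀}ε)⁻¹`).  READING: as `M → ∞` (`ε → 0`), `log(1 + 4M∕l₀) ∼ log M ∼ log log ε⁻¹` and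
`arcosh(1 + log ε⁻¹∕l₀) ∼ log log ε⁻¹`: the deficit in the exponent is `Θ(arcosh(t∕l₀)∕log log ε⁻¹)` on BOTH sides — the «degree currency» of the lineage
(window data of a bounded observable behaves as a polynomial of degree `≍ log ε⁻¹∕log log ε⁻¹` in `e^{t∕M}`: p516009's price is Bernstein's inequality at the
centre, p521610 ∕ this module are Chebyshev's growth outside the interval).

KERNEL-CHECKED (0 `def`, 0 `sorry`): §1 [folklore] `eval_T_eq_cosh_of_one_le`, `eval_T_mono_of_one_le`, `div_le_expm1_ratio` (Bernoulli: `s ≤ (e^{sa} − 1)∕(e^{a} − 1)`,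
`1 ≤ s`, `0 < a`), `abs_sub_le_mul_abs_log_sub_log` (`|a − b| ≤ m·|log a − log b|` for `0 < a, b ≤ m`) · §2 ★ `exists_expsum_witness_offWindow` · §3 ★
`exists_mgf_close_far_offWindow`, `mgf_le_exp_of_Icc`, ★ `exists_cgf_close_far_offWindow` · §4 `cosh_mul_ge_rpow_of_le` (the exponent form of `cosh(Mv)`),
★★ `offWindow_price_two_sided`.

NOT CLAIMED: equality of the constants in the two exponent deficits (`1` below vs `2` above, in different but asymptotically equivalent scales); an `l₀`-uniform form.

HONEST FRAMING (binding).  Elementary; NO consumer in the DAG today; value = optimality certificate (in order) of p521610's off-window price, hence of the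
window-enlargement cost in `…N19OffWindowPriceAtScheme`.  Nothing of [Balaban1987RG1]–[Balaban1989LargeFieldII] or [King1986] is asserted, quoted or
instantiated; NE7 ∕ NE7b ∕ NE7c NOT PRINTED, NOT proved; N19 NOT discharged; Track A count unmoved (typed 28∕28 · discharged 5∕27 · A 5∕28).  One finite `T⁴`
programme at fixed `ε`; nothing continuum ∕ `ℝ⁴` ∕ OS ∕ mass-gap ∕ Clay.  THEOREMS ONLY; standard axioms; no cite tags.
-/

set_option autoImplicit false

noncomputable section

open Polynomial Real Finset MeasureTheory ProbabilityTheory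

namespace Summit.QuantumFields.YangMills.Theorems.BalabanUVNodesN19OffWindowPriceTwoSided

open Summit.QuantumFields.YangMills.Theorems.BalabanUVNodesN19NoLinearPriceWitness
open Summit.QuantumFields.YangMills.Theorems.BalabanUVNodesN19NoLinearPrice
  (expsum_eq_eval abs_expm1_ratio_le_one exists_lawPair_of_weights exp_neg_le_mgf_of_Icc ae_abs_le_one_of_Icc abs_log_sub_log_le)
open Summit.QuantumFields.YangMills.Theorems.BalabanUVNodesN19OffWindowPrice (abs_cgf_sub_cgf_le_offWindow)

/-! ## §1 Chebyshev growth outside the interval, Bernoulli, and `log` from below [folklore] -/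

/-- `T_M(x) = cosh(M·arcosh x)` for `x ≥ 1` (Mathlib's `T_real_cosh` at `θ = arcosh x`). [folklore] -/
theorem eval_T_eq_cosh_of_one_le (M : ℕ) {x : ℝ} (hx : 1 ≤ x) :
    (Chebyshev.T ℝ (M : ℤ)).eval x = cosh (M * arcosh x) := by
  rw [← cosh_arcosh hx, Chebyshev.T_real_cosh, arcosh_cosh (arcosh_nonneg hx)]
  norm_cast

/-- `T_M` is increasing on `[1, ∞)`. [folklore] -/
theorem eval_T_mono_of_one_le (M : ℕ) {x y : ℝ} (hx : 1 ≤ x) (hxy : x ≤ y) :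
    (Chebyshev.T ℝ (M : ℤ)).eval x ≤ (Chebyshev.T ℝ (M : ℤ)).eval y := by
  have hy : 1 ≤ y := hx.trans hxy
  rw [eval_T_eq_cosh_of_one_le M hx, eval_T_eq_cosh_of_one_le M hy, cosh_le_cosh]
  have h1 : 0 ≤ (M : ℝ) * arcosh x := mul_nonneg (Nat.cast_nonneg M) (arcosh_nonneg hx)
  have h2 : 0 ≤ (M : ℝ) * arcosh y := mul_nonneg (Nat.cast_nonneg M) (arcosh_nonneg hy)
  rw [abs_of_nonneg h1, abs_of_nonneg h2]
  exact mul_le_mul_of_nonneg_left ((arcosh_le_arcosh (by linarith) (by linarith)).2 hxy) (Nat.cast_nonneg M)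

/-- Bernoulli: `s ≤ (e^{sa} − 1)∕(e^{a} − 1)` for `1 ≤ s`, `0 < a` (`1 + s(e^{a} − 1) ≤ (e^{a})^{s} = e^{as}`). [folklore] -/
theorem div_le_expm1_ratio {a s : ℝ} (ha : 0 < a) (hs : 1 ≤ s) : s ≤ (exp a - 1)⁻¹ * (exp (s * a) - 1) := by
  have hr : 0 < exp a - 1 := by have := Real.add_one_lt_exp ha.ne'; linarith
  have hB := one_add_mul_self_le_rpow_one_add (s := exp a - 1) (by have := exp_pos a; linarith) hs
  rw [add_sub_cancel, ← Real.exp_mul, mul_comm a s] at hB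
  rw [le_inv_mul_iff₀ hr]
  linarith

/-- `log` from below: `|a − b| ≤ m·|log a − log b|` for `0 < a, b ≤ m` (`1 − x⁻¹ ≤ log x`). [folklore] -/
theorem abs_sub_le_mul_abs_log_sub_log {a b m : ℝ} (ha : 0 < a) (hb : 0 < b) (ham : a ≤ m) (hbm : b ≤ m) :
    |a - b| ≤ m * |log a - log b| := by
  -- the one-sided form: `y − x ≤ y·(log y − log x)` for `0 < x ≤ y`
  have key : ∀ x y : ℝ, 0 < x → x ≤ y → y - x ≤ y * (log y - log x) := fun x y hx hxy => by
    have hy : 0 < y := hx.trans_le hxy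
    have h := Real.one_sub_inv_le_log_of_pos (div_pos hy hx)
    rw [log_div hy.ne' hx.ne', inv_div] at h
    have : y - x = y * (1 - x / y) := by field_simp
    rw [this]
    exact mul_le_mul_of_nonneg_left h hy.le
  rcases le_total a b with hab | hab
  · rw [abs_sub_comm, abs_of_nonneg (sub_nonneg.2 hab), abs_sub_comm,
      abs_of_nonneg (sub_nonneg.2 (log_le_log ha hab))]
    exact (key a b ha hab).trans (mul_le_mul_of_nonneg_right hbm (sub_nonneg.2 (log_le_log ha hab)))
  · rw [abs_of_nonneg (sub_nonneg.2 hab), abs_of_nonneg (sub_nonneg.2 (log_le_log hb hab))]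
    exact (key b a hb hab).trans (mul_le_mul_of_nonneg_right ham (sub_nonneg.2 (log_le_log hb hab)))

/-! ## §2 The grid-Chebyshev weights, read OFF the window -/

/-- **THE WITNESS OFF THE WINDOW.**  For `0 < l₀` and odd `M`: weights `w_0, …, w_M` with `Σ w_j = 0`, `Σ |w_j| = 2` and an `ε` with
`2(1 + 4M∕l₀)^{−M} ≤ ε ≤ 4(l₀e^{l₀}∕(2M))^M` such that `|Σ_j w_j e^{tj∕M}| ≤ ε` on the window `|t| ≤ l₀` and, at every `t ≥ l₀`,
`ε·cosh(M·arcosh(t∕l₀)) ≤ Σ_j w_j e^{tj∕M}` — p510514's construction (`w_j = (2∕Λ)[uʲ]P_M`, `P_M = T_M ∘ ((u−1)∕r)`, `r = e^{l₀∕M} − 1`, `ε = 2∕Λ`) with the one new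
clause from §1 (`(e^{t∕M} − 1)∕r ≥ t∕l₀ ≥ 1` by Bernoulli, `T_M` increasing there, `T_M(x) = cosh(M·arcosh x)`). [folklore] -/
theorem exists_expsum_witness_offWindow {l₀ : ℝ} (hl₀ : 0 < l₀) {M : ℕ} (hM : Odd M) :
    ∃ (w : ℕ → ℝ) (ε : ℝ), 0 < ε ∧ (∀ j, M < j → w j = 0) ∧
      ∑ j ∈ range (M + 1), w j = 0 ∧ ∑ j ∈ range (M + 1), |w j| = 2 ∧
      2 / (1 + 4 * M / l₀) ^ M ≤ ε ∧ ε ≤ 4 * (l₀ * exp l₀ / (2 * M)) ^ M ∧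
      (∀ t : ℝ, |t| ≤ l₀ → |∑ j ∈ range (M + 1), w j * exp (t * j / M)| ≤ ε) ∧
      (∀ t : ℝ, l₀ ≤ t → ε * cosh (M * arcosh (t / l₀)) ≤ ∑ j ∈ range (M + 1), w j * exp (t * j / M)) := by
  have hM0 : 0 < M := hM.pos
  have hMr : (0 : ℝ) < M := Nat.cast_pos.mpr hM0
  have hM1 : (1 : ℝ) ≤ M := by exact_mod_cast hM0
  have ha0 : 0 < l₀ / M := div_pos hl₀ hMr
  set r : ℝ := exp (l₀ / M) - 1 with hr_def
  have hra : l₀ / M ≤ r := by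
    have := Real.add_one_le_exp (l₀ / M)
    rw [hr_def]
    linarith
  have hr0 : 0 < r := lt_of_lt_of_le ha0 hra
  have hal : l₀ / M ≤ l₀ := div_le_self hl₀.le hM1
  have hr_le : r ≤ l₀ * exp l₀ / M := by
    calc r ≤ l₀ / M * exp (l₀ / M) := Literature.Analysis.ODE.exp_sub_one_le_mul_exp _
      _ ≤ l₀ / M * exp l₀ := mul_le_mul_of_nonneg_left (exp_le_exp.mpr hal) ha0.le
      _ = l₀ * exp l₀ / M := by ring
  -- the polynomial and its `ℓ¹`-sum
  set P : ℝ[X] := (Chebyshev.T ℝ M).comp (C r⁻¹ * (X - C 1)) with hP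
  have hPdeg : P.natDegree < M + 1 := by
    rw [hP, natDegree_chebAff hr0.ne']
    exact Nat.lt_succ_self M
  set Λ : ℝ := ∑ j ∈ range (M + 1), |P.coeff j| with hΛ
  have hΛlo : 2 ^ (M - 1) * r⁻¹ ^ M ≤ Λ := pow_le_sum_abs_coeff_chebAff hr0 M
  have hΛhi : Λ ≤ (1 + 4 / r) ^ M := sum_abs_coeff_chebAff_le hr0 M M le_rfl
  have hlead : 0 < (2 : ℝ) ^ (M - 1) * r⁻¹ ^ M := by positivity
  have hΛ0 : 0 < Λ := lt_of_lt_of_le hlead hΛlo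
  have hc0 : 0 < 2 / Λ := by positivity
  have hsum : ∀ g : ℕ → ℝ, ∑ j ∈ range (M + 1), 2 / Λ * P.coeff j * g j =
      2 / Λ * ∑ j ∈ range (M + 1), P.coeff j * g j := by
    intro g
    rw [mul_sum]
    exact sum_congr rfl fun j _ => mul_assoc _ _ _
  refine ⟨fun j => 2 / Λ * P.coeff j, 2 / Λ, hc0, ?_, ?_, ?_, ?_, ?_, ?_, ?_⟩
  · -- support
    intro j hj
    show 2 / Λ * P.coeff j = 0
    rw [coeff_eq_zero_of_natDegree_lt (by rw [hP, natDegree_chebAff hr0.ne']; exact hj), mul_zero]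
  · -- equal mass
    rw [← mul_sum, hP, sum_coeff_chebAff_eq_zero hr0.ne' hM, mul_zero]
  · -- total variation `2`
    have : ∀ j, |2 / Λ * P.coeff j| = 2 / Λ * |P.coeff j| := fun j => by
      rw [abs_mul, abs_of_pos hc0]
    simp_rw [this]
    rw [← mul_sum, ← hΛ, div_mul_cancel₀ _ hΛ0.ne']
  · -- `ε` from below
    rw [div_le_div_iff_of_pos_left two_pos (by positivity) hΛ0]
    refine hΛhi.trans (pow_le_pow_left₀ (by positivity) ?_ M)
    have h4 : 4 / r ≤ 4 * M / l₀ := by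
      rw [mul_div_assoc, div_eq_mul_inv 4 r]
      refine mul_le_mul_of_nonneg_left ?_ (by norm_num)
      calc r⁻¹ ≤ (l₀ / M)⁻¹ := by rw [inv_le_inv₀ hr0 ha0]; exact hra
        _ = M / l₀ := by rw [inv_div]
    linarith
  · -- `ε` from above
    calc 2 / Λ ≤ 2 / (2 ^ (M - 1) * r⁻¹ ^ M) := div_le_div_of_nonneg_left zero_le_two hlead hΛlo
      _ = 4 * (r / 2) ^ M := by
          obtain ⟨k, rfl⟩ := Nat.exists_eq_add_of_le' hM0
          rw [Nat.add_sub_cancel, div_pow, inv_pow, pow_succ (2 : ℝ) k]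
          field_simp
          ring
      _ ≤ 4 * (l₀ * exp l₀ / (2 * M)) ^ M := by
          gcongr 4 * ?_ ^ M
          calc r / 2 ≤ l₀ * exp l₀ / M / 2 := by gcongr
            _ = l₀ * exp l₀ / (2 * M) := by ring
  · -- the window bound
    intro t ht
    rw [hsum, expsum_eq_eval P hPdeg M t, abs_mul, abs_of_pos hc0]
    refine mul_le_of_le_one_right hc0.le ?_
    rw [hP]
    exact abs_eval_chebAff_le_one r M (by rw [hr_def]; exact abs_expm1_ratio_le_one hl₀ hM0 ht)
  · -- OFF the window: Chebyshev growth
    intro t ht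
    rw [hsum, expsum_eq_eval P hPdeg M t, hP, eval_chebAff]
    refine mul_le_mul_of_nonneg_left ?_ hc0.le
    have hs : 1 ≤ t / l₀ := by rwa [le_div_iff₀ hl₀, one_mul]
    have hx : t / l₀ ≤ r⁻¹ * (exp (t / M) - 1) := by
      have h := div_le_expm1_ratio ha0 hs
      rwa [show t / l₀ * (l₀ / M) = t / M by field_simp, ← hr_def] at h
    calc cosh (M * arcosh (t / l₀)) = (Chebyshev.T ℝ (M : ℤ)).eval (t / l₀) := (eval_T_eq_cosh_of_one_le M hs).symm
      _ ≤ (Chebyshev.T ℝ (M : ℤ)).eval (r⁻¹ * (exp (t / M) - 1)) := eval_T_mono_of_one_le M hs hx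

/-! ## §3 Two probability laws on `[0, 1]`: mgf's and cgf's close on the window, far OFF it -/

/-- **MGF's CLOSE ON THE WINDOW, FAR OFF IT.**  For `0 < l₀` and odd `M`: two probability laws on `[0, 1]` and `ε` with
`2(1 + 4M∕l₀)^{−M} ≤ ε ≤ 4(l₀e^{l₀}∕(2M))^M`, `|mgf_ν(t) − mgf_μ(t)| ≤ ε` on `|t| ≤ l₀`, and `ε·cosh(M·arcosh(t∕l₀)) ≤ mgf_ν(t) − mgf_μ(t)` at every `t ≥ l₀`
(§2's weights through p510514's `exists_lawPair_of_weights`). [folklore] -/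
theorem exists_mgf_close_far_offWindow {l₀ : ℝ} (hl₀ : 0 < l₀) {M : ℕ} (hM : Odd M) :
    ∃ μ ν : Measure ℝ, IsProbabilityMeasure μ ∧ IsProbabilityMeasure ν ∧
      μ (Set.Icc 0 1)ᶜ = 0 ∧ ν (Set.Icc 0 1)ᶜ = 0 ∧
      ∃ ε : ℝ, 0 < ε ∧ 2 / (1 + 4 * M / l₀) ^ M ≤ ε ∧ ε ≤ 4 * (l₀ * exp l₀ / (2 * M)) ^ M ∧
        (∀ t : ℝ, |t| ≤ l₀ → |mgf id ν t - mgf id μ t| ≤ ε) ∧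
        (∀ t : ℝ, l₀ ≤ t → ε * cosh (M * arcosh (t / l₀)) ≤ mgf id ν t - mgf id μ t) := by
  obtain ⟨w, ε, hε, -, h0, h2, hlo, hhi, hwin, hoff⟩ := exists_expsum_witness_offWindow hl₀ hM
  obtain ⟨μ, ν, iμ, iν, hμ, hν, hg⟩ := exists_lawPair_of_weights w h0 h2
  have hmgf : ∀ t : ℝ, mgf id ν t - mgf id μ t = ∑ j ∈ range (M + 1), w j * exp (t * j / M) := by
    intro t
    simp only [mgf, id]
    rw [hg fun x => exp (t * x)]
    refine sum_congr rfl fun j _ => ?_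
    rw [mul_div_assoc]
  refine ⟨μ, ν, iμ, iν, hμ, hν, ε, hε, hlo, hhi, fun t ht => ?_, fun t ht => ?_⟩
  · rw [hmgf]
    exact hwin t ht
  · rw [hmgf]
    exact hoff t ht

/-- A probability law on `[0, 1]` has `mgf ≤ e^{t}` for `t ≥ 0`. [folklore] -/
theorem mgf_le_exp_of_Icc {μ : Measure ℝ} [IsProbabilityMeasure μ] (hμ : μ (Set.Icc 0 1)ᶜ = 0) {t : ℝ} (ht : 0 ≤ t) :
    mgf id μ t ≤ exp t := by
  have h := Literature.MathematicalPhysics.QuantumFieldTheory.Balaban1983to89.T4GenFunBounds.mgf_le_of_abs_le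
    (ae_abs_le_one_of_Icc hμ) t
  rwa [probReal_univ, one_mul, abs_of_nonneg ht, mul_one] at h

/-- **… HENCE CGF's `e^{l₀}ε`-CLOSE ON THE WINDOW AND `e^{−t}·ε·cosh(M·arcosh(t∕l₀))`-FAR OFF IT** (mgf's `≥ e^{−l₀}` on the window, `≤ e^{t}` at `t ≥ 0`;
`log` is `e^{l₀}`-Lipschitz from above there and `e^{−t}`-co-Lipschitz from below here). [folklore] -/
theorem exists_cgf_close_far_offWindow {l₀ : ℝ} (hl₀ : 0 < l₀) {M : ℕ} (hM : Odd M) :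
    ∃ μ ν : Measure ℝ, IsProbabilityMeasure μ ∧ IsProbabilityMeasure ν ∧
      μ (Set.Icc 0 1)ᶜ = 0 ∧ ν (Set.Icc 0 1)ᶜ = 0 ∧
      ∃ ε : ℝ, 0 < ε ∧ 2 / (1 + 4 * M / l₀) ^ M ≤ ε ∧ ε ≤ 4 * (l₀ * exp l₀ / (2 * M)) ^ M ∧
        (∀ t : ℝ, |t| ≤ l₀ → |cgf id ν t - cgf id μ t| ≤ exp l₀ * ε) ∧
        (∀ t : ℝ, l₀ ≤ t → exp (-t) * (ε * cosh (M * arcosh (t / l₀))) ≤ |cgf id ν t - cgf id μ t|) := by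
  obtain ⟨μ, ν, iμ, iν, hμ, hν, ε, hε, hlo, hhi, hwin, hoff⟩ := exists_mgf_close_far_offWindow hl₀ hM
  refine ⟨μ, ν, iμ, iν, hμ, hν, ε, hε, hlo, hhi, fun t ht => ?_, fun t ht => ?_⟩
  · have hm : 0 < exp (-l₀) := exp_pos _
    calc |cgf id ν t - cgf id μ t| ≤ |mgf id ν t - mgf id μ t| / exp (-l₀) :=
          abs_log_sub_log_le hm (exp_neg_le_mgf_of_Icc hν ht) (exp_neg_le_mgf_of_Icc hμ ht)
      _ ≤ ε / exp (-l₀) := div_le_div_of_nonneg_right (hwin t ht) hm.le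
      _ = exp l₀ * ε := by rw [Real.exp_neg, div_inv_eq_mul, mul_comm]
  · have ht0 : 0 ≤ t := hl₀.le.trans ht
    have hνpos : 0 < mgf id ν t := (exp_pos _).trans_le (exp_neg_le_mgf_of_Icc hν (le_of_eq (abs_of_nonneg ht0)))
    have hμpos : 0 < mgf id μ t := (exp_pos _).trans_le (exp_neg_le_mgf_of_Icc hμ (le_of_eq (abs_of_nonneg ht0)))
    have h := abs_sub_le_mul_abs_log_sub_log hνpos hμpos (mgf_le_exp_of_Icc hν ht0) (mgf_le_exp_of_Icc hμ ht0)
    rw [cgf, cgf]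
    rw [← div_le_iff₀' (exp_pos t)] at h
    refine le_trans ?_ h
    rw [Real.exp_neg, ← div_eq_inv_mul]
    exact div_le_div_of_nonneg_right ((hoff t ht).trans (le_abs_self _)) (exp_pos t).le

/-! ## §4 The exponent form and the two-sided statement -/

/-- **The exponent form of the Chebyshev growth.**  From `2∕(1 + 4M∕l₀)^M ≤ ε` (`0 < ε`, `0 < l₀`, `1 ≤ M`) and `0 ≤ v`:
`(ε∕2)^{1 − v∕log(1 + 4M∕l₀)} ≤ ε·cosh(M·v)` (`cosh(Mv) ≥ ½e^{Mv}` and `M ≥ log(2∕ε)∕log(1 + 4M∕l₀)`). [folklore] -/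
theorem cosh_mul_ge_rpow_of_le {l₀ ε v : ℝ} {M : ℕ} (hl₀ : 0 < l₀) (hM : 1 ≤ M) (hε : 0 < ε) (hv : 0 ≤ v)
    (hlo : 2 / (1 + 4 * M / l₀) ^ M ≤ ε) :
    (ε / 2) ^ (1 - v / log (1 + 4 * M / l₀)) ≤ ε * cosh (M * v) := by
  have hMr : (1 : ℝ) ≤ M := by exact_mod_cast hM
  set q : ℝ := 1 + 4 * M / l₀ with hq
  have h4M : 0 < 4 * (M : ℝ) / l₀ := by positivity
  have hq1 : 1 < q := by rw [hq]; linarith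
  have hq0 : 0 < q := one_pos.trans hq1
  have hlogq : 0 < log q := log_pos hq1
  have hε2 : 0 < ε / 2 := by positivity
  -- `(ε/2)⁻¹ ≤ q^M`, so `log (2/ε) ≤ M log q`
  have hinv : (ε / 2)⁻¹ ≤ q ^ (M : ℝ) := by
    rw [Real.rpow_natCast, inv_le_comm₀ hε2 (pow_pos hq0 M)]
    calc (q ^ M)⁻¹ = 2 / q ^ M / 2 := by ring
      _ ≤ ε / 2 := by gcongr
  have hlog : log (ε / 2)⁻¹ ≤ M * log q := by
    have h := log_le_log (inv_pos.2 hε2) hinv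
    rwa [Real.log_rpow hq0] at h
  -- `(ε/2)^{−v/log q} = exp (v · log (2/ε) / log q) ≤ exp (M v)`
  have hexp : (ε / 2) ^ (-(v / log q)) ≤ exp (M * v) := by
    rw [Real.rpow_def_of_pos hε2, exp_le_exp]
    have e : log (ε / 2) * -(v / log q) = v * (log (ε / 2)⁻¹ / log q) := by rw [Real.log_inv]; ring
    rw [e]
    calc v * (log (ε / 2)⁻¹ / log q) ≤ v * M := by
          refine mul_le_mul_of_nonneg_left ?_ hv
          rw [div_le_iff₀ hlogq]
          exact hlog
      _ = M * v := mul_comm _ _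
  -- assemble: `(ε/2)^{1 − v/log q} = (ε/2)·(ε/2)^{−v/log q} ≤ (ε/2)·e^{Mv} ≤ ε cosh(Mv)`
  have hsplit : (ε / 2) ^ (1 - v / log q) = ε / 2 * (ε / 2) ^ (-(v / log q)) := by
    rw [sub_eq_add_neg, Real.rpow_add hε2, Real.rpow_one]
  rw [hsplit]
  calc ε / 2 * (ε / 2) ^ (-(v / log q)) ≤ ε / 2 * exp (M * v) := mul_le_mul_of_nonneg_left hexp hε2.le
    _ ≤ ε * cosh (M * v) := by
        rw [Real.cosh_eq]
        have := exp_pos (-(M * v))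
        nlinarith [hε]

/-- **THE OFF-WINDOW PRICE IS TWO-SIDED.**  For every window `0 < l₀` and every odd `M` there are two probability laws `μ`, `ν` on `[0, 1]` and an
`ε` with `2(1 + 4M∕l₀)^{−M} ≤ ε ≤ 4(l₀e^{l₀}∕(2M))^M` (so `log ε⁻¹ ≍_{l₀} M log M`) whose cgf's are `e^{l₀}ε`-close on `|t| ≤ l₀` while at every source `t ≥ l₀`
`e^{−t}·(ε∕2)^{1 − arcosh(t∕l₀)∕log(1 + 4M∕l₀)} ≤ |cgf_ν(t) − cgf_μ(t)|` (this module), and, wherever p521610 speaks (`t − l₀ ≤ log⁺(e^{l₀}ε)⁻¹`),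
`|cgf_ν(t) − cgf_μ(t)| ≤ 2e^{l₀+t}·(e^{l₀}ε)^{1 − 2·arcosh(t∕l₀)∕arcosh(1 + log⁺(e^{l₀}ε)⁻¹∕l₀)}` (p521610's `abs_cgf_sub_cgf_le_offWindow` at `X = Y = id`, `B = 1`).
Both exponent deficits are `≍ arcosh(t∕l₀)∕log log ε⁻¹` as `M → ∞` (`log(1+4M∕l₀) ∼ log M`, `arcosh(1 + log ε⁻¹∕l₀) ∼ log log ε⁻¹`, `log ε⁻¹ ≍_{l₀} M log M`). [folklore] -/
theorem offWindow_price_two_sided {l₀ : ℝ} (hl₀ : 0 < l₀) {M : ℕ} (hM : Odd M) :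
    ∃ μ ν : Measure ℝ, IsProbabilityMeasure μ ∧ IsProbabilityMeasure ν ∧
      μ (Set.Icc 0 1)ᶜ = 0 ∧ ν (Set.Icc 0 1)ᶜ = 0 ∧
      ∃ ε : ℝ, 0 < ε ∧ 2 / (1 + 4 * M / l₀) ^ M ≤ ε ∧ ε ≤ 4 * (l₀ * exp l₀ / (2 * M)) ^ M ∧
        (∀ t : ℝ, |t| ≤ l₀ → |cgf id ν t - cgf id μ t| ≤ exp l₀ * ε) ∧
        (∀ t : ℝ, l₀ ≤ t →
          exp (-t) * (ε / 2) ^ (1 - arcosh (t / l₀) / log (1 + 4 * M / l₀)) ≤ |cgf id ν t - cgf id μ t|) ∧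
        (∀ t : ℝ, l₀ ≤ t → t - l₀ ≤ posLog (exp l₀ * ε)⁻¹ →
          |cgf id ν t - cgf id μ t| ≤ 2 * exp (l₀ + t) *
            (exp l₀ * ε) ^ (1 - 2 * arcosh (t / l₀) / arcosh (1 + posLog (exp l₀ * ε)⁻¹ / l₀))) := by
  obtain ⟨μ, ν, iμ, iν, hμ, hν, ε, hε, hlo, hhi, hwin, hoff⟩ := exists_cgf_close_far_offWindow hl₀ hM
  refine ⟨μ, ν, iμ, iν, hμ, hν, ε, hε, hlo, hhi, hwin, fun t ht => ?_, fun t ht hL => ?_⟩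
  · have hv : 0 ≤ arcosh (t / l₀) := arcosh_nonneg (by rwa [le_div_iff₀ hl₀, one_mul])
    have h := cosh_mul_ge_rpow_of_le hl₀ hM.pos hε hv hlo
    exact le_trans (mul_le_mul_of_nonneg_left h (exp_pos _).le) (hoff t ht)
  · have ht0 : 0 ≤ t := hl₀.le.trans ht
    have habs : |t| = t := abs_of_nonneg ht0
    have key := abs_cgf_sub_cgf_le_offWindow (μ := μ) (ν := ν) (X := id) (Y := id) (B := 1) aemeasurable_id aemeasurable_id
      (ae_abs_le_one_of_Icc hμ) (ae_abs_le_one_of_Icc hν) (ε := exp l₀ * ε) (t := t) hl₀ one_pos (by positivity) hwin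
      (by rw [habs]; exact ht) (by rw [habs, one_mul]; exact hL)
    rw [habs, mul_one, mul_one] at key
    exact key

end Summit.QuantumFields.YangMills.Theorems.BalabanUVNodesN19OffWindowPriceTwoSided

end
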